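import Summits.CriticalPhenomena.PercolationContinuityZ3.Theorems.PercNearOneGluingNoHeavyPcintBSMRAssembly
import Summits.CriticalPhenomena.PercolationContinuityZ3.Theorems.PercNearOneGluingNoHeavyPcintBSMXKernel
import HarnessLib

/-!
# PCINT lane, PHASE 9 (block renewal with reach-`m` pieces), step 7: the kernel theorem

Cell `prim-pcint`, seat `prim-pcint-1` (gen 17); memo `run/shared/lean/prim/pcint/T-FIBRE-ROUTE.md` §PHASE 9.

The reach-`m` analogue of `BSMX.criticalProb_le_of_checks5` (…PcintBSMXKernel): the natural-number marginal
identity `BSMR.MargN` over the coded list box `[-m,m]^t` (weights `W/DW`, law `A/DA`), and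
**`BSMR.criticalProb_le_of_checks`**: decidable hypotheses in natural/integer arithmetic (the reach-`m` cube
conditions, the marginal identity, real-form Green-table domination on canonical offsets covering `[-6m,6m]^t`
(discharged by …PcintBSMRRows), potential-table domination on `[-4m,4m]^t`, the PHASE-5 integer certificate
functional `BSM.certLHSz` on `[-2m,2m]^t` with any shared-key count `St` agreeing with `BSM.S` there), plus a tail
bound `BSMR.TailBoundH` (discharged from `ℚ` data in …PcintBSMRTail), imply `p_c^bond(ℤ^{k+t}) ≤ P/10^4`.
-/

noncomputable section

namespace Summit.CriticalPhenomena.PercolationContinuityZ3.Theorems.Pcint.BSMR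

open Finset OSM BSM Literature.Probability.Percolation Literature.Probability.LatticeModels

variable {m t k np : ℕ}

/-! ### The natural marginal identity -/

/-- Every letter vector is coded by a point of `[-m,m]^t`. -/
theorem exists_boxList_code (v : Fin t → Fin (2 * m + 1)) : ∃ δ ∈ boxList t m, v = fun i => code m (δ i) := by
  refine ⟨fun i => val m (v i), (mem_boxList m _).2 fun i => ?_, funext fun i => (code_val (v i)).symm⟩
  exact abs_le.1 (abs_val_le (v i))

/-- **The natural marginal hypothesis**, quantified over the list box `[-m,m]^t` of coded letter vectors:
`(Σ_{σ : codev σ = code ∘ δ} W σ) · DA^t = DW · Π_i A[code (δ i)]`. -/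
def MargN (m : ℕ) (pc : Fin np → List (Fin t × Bool)) (W : Fin np → ℕ) (DW : ℕ) (A : List ℕ) (DA : ℕ) : Prop :=
  ∀ δ ∈ boxList t m, (∑ σ : Fin np, (if codev m pc σ = (fun i => code m (δ i)) then W σ else 0)) * DA ^ t =
    DW * ∏ i, A.getD (code m (δ i)) 0

/-- The natural marginal hypothesis gives the real one for the weights `W/DW` and the law `A/DA`. -/
theorem marg_of_margN {pc : Fin np → List (Fin t × Bool)} {W : Fin np → ℕ} {DW : ℕ} {A : List ℕ} {DA : ℕ}
    (hDW : 0 < DW) (hDA : 0 < DA) (h : MargN m pc W DW A DA) :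
    Marg m pc (fun σ => (W σ : ℝ) / DW) (lawN m A DA) := by
  intro v
  obtain ⟨δ, hδ, rfl⟩ := exists_boxList_code v
  have hDWR : (0 : ℝ) < DW := by exact_mod_cast hDW
  have hDAR : (0 : ℝ) < DA := by exact_mod_cast hDA
  have e := congr_arg (fun n : ℕ => (n : ℝ)) (h δ hδ)
  push_cast at e
  -- left side: `(Σ_σ ite) / DW`; right side: `Π_i A_i / DA = (Π A_i) / DA^t`
  have hl : ∑ σ : Fin np, (if (codev m pc σ = fun i => code m (δ i)) then (W σ : ℝ) / DW else 0) =
      (∑ σ : Fin np, (if (codev m pc σ = fun i => code m (δ i)) then (W σ : ℝ) else 0)) / DW := by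
    rw [sum_div]; exact sum_congr rfl fun σ _ => by split_ifs <;> simp
  have hr : ∏ i, lawN m A DA (code m (δ i)) = (∏ i, ((A.getD (code m (δ i)) 0 : ℕ) : ℝ)) / (DA : ℝ) ^ t := by
    unfold lawN
    rw [prod_div_distrib, prod_const, card_univ, Fintype.card_fin]
  rw [hl, hr, div_eq_div_iff hDWR.ne' (by positivity)]
  have e' : (∑ σ : Fin np, (if (codev m pc σ = fun i => code m (δ i)) then (W σ : ℝ) else 0)) * (DA : ℝ) ^ t =
      (DW : ℝ) * ∏ i, ((A.getD (code m (δ i)) 0 : ℕ) : ℝ) := by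
    convert e using 2
  linarith [e']

/-- Sums of naturals over the list box `[-2m,2m]^t`, cast to `ℝ`. -/
theorem cast_boxSum (m : ℕ) (G Φn : (Fin t → ℤ) → ℕ) (Tn : ℕ) (u : Fin t → ℤ) :
    (((1 + ((boxList t (2 * m)).map fun z => (G (canonK (z - u)) + Tn) * Φn z).sum : ℕ) : ℝ)) =
      1 + ∑ z ∈ Box t (2 * m), (((G (canonK (z - u)) : ℝ) + Tn) * Φn z) := by
  rw [Nat.cast_add, Nat.cast_one, Nat.cast_list_sum, List.map_map, sum_Box_eq]
  congr 1
  exact congr_arg _ (List.map_congr_left fun z _ => by simp only [Function.comp_apply]; push_cast; ring)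

/-! ### The kernel theorem -/

/-- **`p_c^bond(ℤ^{k+t}) ≤ P/10^4` from decidable checks** (integer certificate, reach `m`). -/
theorem criticalProb_le_of_checks (hk : 2 ≤ k) (pc : Fin np → List (Fin t × Bool))
    (pe : Fin np → (Fin t → ℤ)) (hpe : ∀ σ, pe σ = pend (pc σ)) (E : ℕ) (hE : ∀ σ, (pc σ).length + 1 ≤ E)
    (St : (Fin t → ℤ) → Fin np → Fin np → ℕ) (hSt : ∀ y ∈ boxList t (2 * m), ∀ σ σ', St y σ σ' = S pc k y σ σ')
    (W : Fin np → ℕ) (DW : ℕ) (hDW : 0 < DW)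
    {A : List ℕ} {DA : ℕ} (hA : LawNatOK m A DA)
    (hcube : Cube m pc) (hkc : KeyCube m pc k) (hmarg : MargN m pc W DW A DA) {P : ℕ} (hP0 : 0 < P) (hP1 : P ≤ 10000)
    {N : ℕ} (DG DΦ Tn : ℕ) (hDG : 0 < DG) (hDΦ : 0 < DΦ)
    (hT : TailBoundH t k m (lawN m A DA) N ((Tn : ℝ) / DG))
    (G0n G1n V0n V1n Φn : (Fin t → ℤ) → ℕ) (CL : List (Fin t → ℤ)) (hCL : ∀ δ ∈ boxList t (6 * m), canonK δ ∈ CL)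
    (hG0 : ∀ δ ∈ CL, G0H k m (lawN m A DA) N δ * DG ≤ G0n δ)
    (hG1 : ∀ δ ∈ CL, G1H k m (lawN m A DA) N δ * DG ≤ G1n δ)
    (hV0 : ∀ u ∈ boxList t (4 * m),
      1 + ((boxList t (2 * m)).map fun z => (G0n (canonK (z - u)) + Tn) * Φn z).sum ≤ V0n u)
    (hV1 : ∀ u ∈ boxList t (4 * m),
      1 + ((boxList t (2 * m)).map fun z => (G1n (canonK (z - u)) + Tn) * Φn z).sum ≤ V1n u)
    (hcert : ∀ y ∈ boxList t (2 * m), certLHSz pe St W k 10000 P E V0n V1n y * DΦ ≤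
      (Φn y : ℤ) * ((P ^ E * k * DW ^ 2 * (DG * DΦ) : ℕ) : ℤ)) :
    criticalProb (zdGraph (k + t)) (0 : Site (k + t)) ≤ (P : ℝ) / 10000 := by
  have hPR : (0 : ℝ) < P := by exact_mod_cast hP0
  have hDGR : (0 : ℝ) < DG := by exact_mod_cast hDG
  have hDΦR : (0 : ℝ) < DΦ := by exact_mod_cast hDΦ
  have hDWR : (0 : ℝ) < DW := by exact_mod_cast hDW
  have hg := lawOK_of_nat hA
  set g := lawN m A DA with hgdef
  have hp0 : (0 : ℝ) < (P : ℝ) / 10000 := by positivity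
  have hp1 : (P : ℝ) / 10000 ≤ 1 := by rw [div_le_one (by norm_num)]; exact_mod_cast hP1
  -- the weights
  set w : Fin np → ℝ := fun σ => (W σ : ℝ) / DW with hw
  have hmarg' : Marg m pc w g := marg_of_margN hDW hA.1 hmarg
  have hw0 : ∀ σ, 0 ≤ w σ := fun σ => by rw [hw]; positivity
  -- boxes: `z ∈ [-2m,2m]^t`, `u ∈ [-4m,4m]^t` ⇒ `z - u ∈ [-6m,6m]^t`
  have hzu : ∀ z ∈ boxList t (2 * m), ∀ u ∈ boxList t (4 * m), z - u ∈ boxList t (6 * m) := by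
    intro z hz u hu
    rw [mem_boxList] at hz hu ⊢
    intro i
    have h1 := hz i; have h2 := hu i
    simp only [Pi.sub_apply]
    push_cast at h1 h2 ⊢
    constructor <;> omega
  have hYb : ∀ z, z ∈ Box t (2 * m) → z ∈ boxList t (2 * m) := fun z hz => by
    rwa [Box_eq_toFinset t (2 * m), List.mem_toFinset] at hz
  -- the potential, extended by zero outside `[-2m,2m]^t`, and the tables over `ℝ`
  set φ : (Fin t → ℤ) → ℝ := fun y => if y ∈ boxList t (2 * m) then (Φn y : ℝ) / DΦ else 0 with hφdef
  have hφ0 : ∀ y, 0 ≤ φ y := fun y => by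
    rw [hφdef]; dsimp only; split_ifs
    · positivity
    · exact le_rfl
  have hφin : ∀ y ∈ boxList t (2 * m), φ y = (Φn y : ℝ) / DΦ := fun y hy => by
    rw [hφdef]; dsimp only; rw [if_pos hy]
  set V0f : (Fin t → ℤ) → ℝ := fun u => (V0n u : ℝ) / ((DG * DΦ : ℕ) : ℝ) with hV0f
  set V1f : (Fin t → ℤ) → ℝ := fun u => (V1n u : ℝ) / ((DG * DΦ : ℕ) : ℝ) with hV1f
  -- Green tables over `ℝ`
  have hG0' : ∀ z ∈ boxList t (2 * m), ∀ u ∈ boxList t (4 * m),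
      G0H k m g N (z - u) + (Tn : ℝ) / DG ≤ (((G0n (canonK (z - u)) : ℝ) + Tn) / DG) := by
    intro z hz u hu
    rw [add_div]
    refine add_le_add ?_ le_rfl
    rw [← G0H_canonK k hg, le_div_iff₀ hDGR]
    exact hG0 _ (hCL _ (hzu z hz u hu))
  have hG1' : ∀ z ∈ boxList t (2 * m), ∀ u ∈ boxList t (4 * m),
      G1H k m g N (z - u) + (Tn : ℝ) / DG ≤ (((G1n (canonK (z - u)) : ℝ) + Tn) / DG) := by
    intro z hz u hu
    rw [add_div]
    refine add_le_add ?_ le_rfl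
    rw [← G1H_canonK k hg, le_div_iff₀ hDGR]
    exact hG1 _ (hCL _ (hzu z hz u hu))
  -- the potential tables over `ℝ`
  have hVgen : ∀ (Gr : (Fin t → ℤ) → ℝ) (Gn Vn : (Fin t → ℤ) → ℕ),
      (∀ z ∈ boxList t (2 * m), ∀ u ∈ boxList t (4 * m),
        Gr (z - u) + (Tn : ℝ) / DG ≤ (((Gn (canonK (z - u)) : ℝ) + Tn) / DG)) →
      (∀ u ∈ boxList t (4 * m), 1 + ((boxList t (2 * m)).map fun z => (Gn (canonK (z - u)) + Tn) * Φn z).sum ≤ Vn u) →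
      ∀ u ∈ Box t (4 * m), (1 / ((DG * DΦ : ℕ) : ℝ) + ∑ z ∈ Box t (2 * m), (Gr (z - u) + (Tn : ℝ) / DG) * φ z) ≤
        (Vn u : ℝ) / ((DG * DΦ : ℕ) : ℝ) := by
    intro Gr Gn Vn hGr hVn u hu
    rw [Box_eq_toFinset, List.mem_toFinset] at hu
    have hsum : ∑ z ∈ Box t (2 * m), (Gr (z - u) + (Tn : ℝ) / DG) * φ z ≤
        ∑ z ∈ Box t (2 * m), ((((Gn (canonK (z - u)) : ℝ) + Tn) / DG) * ((Φn z : ℝ) / DΦ)) :=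
      sum_le_sum fun z hz => by
        rw [hφin z (hYb z hz)]
        exact mul_le_mul_of_nonneg_right (hGr z (hYb z hz) u hu) (by positivity)
    have hcast : ((Vn u : ℝ)) ≥
        ((1 + ((boxList t (2 * m)).map fun z => (Gn (canonK (z - u)) + Tn) * Φn z).sum : ℕ) : ℝ) := by
      exact_mod_cast hVn u hu
    rw [cast_boxSum m] at hcast
    have heq : ∑ z ∈ Box t (2 * m), ((((Gn (canonK (z - u)) : ℝ) + Tn) / DG) * ((Φn z : ℝ) / DΦ)) =
        (∑ z ∈ Box t (2 * m), (((Gn (canonK (z - u)) : ℝ) + Tn) * Φn z)) / ((DG * DΦ : ℕ) : ℝ) := by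
      rw [Finset.sum_div]
      exact sum_congr rfl fun z _ => by push_cast; ring
    rw [heq] at hsum
    have hpos : (0 : ℝ) < ((DG * DΦ : ℕ) : ℝ) := by positivity
    calc 1 / ((DG * DΦ : ℕ) : ℝ) + ∑ z ∈ Box t (2 * m), (Gr (z - u) + (Tn : ℝ) / DG) * φ z
        ≤ (1 + ∑ z ∈ Box t (2 * m), (((Gn (canonK (z - u)) : ℝ) + Tn) * Φn z)) / ((DG * DΦ : ℕ) : ℝ) := by
          rw [add_div]; exact add_le_add le_rfl hsum
      _ ≤ (Vn u : ℝ) / ((DG * DΦ : ℕ) : ℝ) := div_le_div_of_nonneg_right hcast hpos.le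
  have hV0' : ∀ u ∈ Box t (4 * m), V0H k m g N ((Tn : ℝ) / DG) (1 / ((DG * DΦ : ℕ) : ℝ)) φ u ≤ V0f u :=
    hVgen (G0H k m g N) G0n V0n hG0' hV0
  have hV1' : ∀ u ∈ Box t (4 * m), V1H k m g N ((Tn : ℝ) / DG) (1 / ((DG * DΦ : ℕ) : ℝ)) φ u ≤ V1f u :=
    hVgen (G1H k m g N) G1n V1n hG1' hV1
  -- the certificate inequalities over `ℝ`
  have hx : (1 / ((P : ℝ) / 10000)) = ((10000 : ℕ) : ℝ) / P := by push_cast; field_simp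
  have hcert' : ∀ y ∈ Box t (2 * m), certLHS pc w k (1 / ((P : ℝ) / 10000)) V0f V1f y ≤ φ y := by
    intro y hy
    replace hy := hYb y hy
    have h := (Int.cast_mono (R := ℝ)) (hcert y hy)
    have hSt' : certLHSz pe St W k 10000 P E V0n V1n y = certLHSz pe (S pc k) W k 10000 P E V0n V1n y := by
      unfold certLHSz; simp only [hSt y hy]
    rw [hSt'] at h
    push_cast at h
    rw [certLHSz_cast pc hpe W (by omega) 10000 hP0 hE V0n V1n y hDW (by positivity : 0 < DG * DΦ)] at h
    rw [hx, hφin y hy]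
    rw [hw, hV0f, hV1f]
    push_cast at h ⊢
    have hMpos : (0 : ℝ) < (k : ℝ) * (P : ℝ) ^ E * (DW : ℝ) ^ 2 * ((DG : ℝ) * DΦ) * DΦ := by positivity
    refine le_of_mul_le_mul_right ?_ hMpos
    calc _ = certLHS pc (fun σ => (W σ : ℝ) / DW) k ((10000 : ℝ) / P) (fun u => (V0n u : ℝ) / ((DG : ℝ) * DΦ))
          (fun u => (V1n u : ℝ) / ((DG : ℝ) * DΦ)) y * ((k : ℝ) * (P : ℝ) ^ E * (DW : ℝ) ^ 2 * ((DG : ℝ) * DΦ)) * DΦ := by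
          ring
      _ ≤ (Φn y : ℝ) * ((P : ℝ) ^ E * k * (DW : ℝ) ^ 2 * ((DG : ℝ) * DΦ)) := h
      _ = _ := by field_simp
  exact criticalProb_le_of_cert hk hg hcube hkc hmarg' hw0 hp0 hp1 hT (by positivity) φ hφ0 hV0' hV1' hcert'

end Summit.CriticalPhenomena.PercolationContinuityZ3.Theorems.Pcint.BSMR

end
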